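import Literature.NumberTheory.LFunctions.RobinAnalytic
import Literature.NumberTheory.LFunctions.ColossallyAbundantExponents
import Literature.NumberTheory.LFunctions.ColossallyAbundantStructure
import Literature.NumberTheory.LFunctions.RobinNumerical
import Literature.NumberTheory.LFunctions.RobinOscillation
import HarnessLib

/-!
# Robin's criterion from four published facts (Robin 1984, Thm. 1 and §4 Prop. 1)

Topic: `Literature/NumberTheory/LFunctions`. Pure proof file (no definition, nothing asserted):
the assembly step of provefact `Literature.NumberTheory.LFunctions.robin_iff` (`RHClassicalEquivalents.lean`:
`RH ↔ ∀ n > 5040, σ(n) < e^γ n log log n`). It reduces Robin's criterion to four named facts,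
each a published statement about primes or a published computation:

* `Literature.NumberTheory.LFunctions.Nicolas2012_logf_lower` — Nicolas 2012, Prop. 2.1 (Mertens' product against
  `log θ(x)` under RH, `x ≥ 10⁹`);
* `Literature.NumberTheory.LFunctions.Schoenfeld1976_theta` — Schoenfeld 1976 (`|θ(x) − x| ≤ √x log²x/(8π)` under RH,
  `x ≥ 599`);
* `Literature.NumberTheory.LFunctions.Briggs2006_robinInequality_le` — Briggs 2006 / Axler 2017 (Robin's inequality for
  `5041 ≤ n ≤ 10^(10^10)`);
* `Literature.NumberTheory.LFunctions.Nicolas1983_logf_omega` — Nicolas 1983 (`log f(x) = Ω_±(x^{−b})` if RH fails).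

**Results.**

* `Robin1984_thm1_colossallyAbundant_of_nicolas` — the colossally abundant case of Robin's
  Thm. 1 (`RobinCriterion.lean`) from the first three facts: for a colossally abundant
  `N > 5040` with largest prime `P` (`ColossallyAbundant.exists_structure`), either
  `P < 2·10¹⁰`, and then `log N ≤ θ(P) + √u log u ≤ 10¹⁰ log 10`
  (`RobinAnalytic.theta_add_size_le`), so Briggs's range applies; or `P ≥ 2·10¹⁰`, and then
  `σ(N)/N ≤ (∏_{p≤P}(1−1/p))⁻¹ ∏_{Q<p≤P}(1−1/p²) < e^γ log(θ(P)+θ(Q)) ≤ e^γ log log N`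
  (`RobinAnalytic.mertens_prod_lt`).
* `Robin1984_thm1_of_nicolas` — Robin's Thm. 1 (`RH ⟹ σ(n) < e^γ n log log n`, `n > 5040`),
  by `Robin1984_thm1_of_colossallyAbundant` (`RobinNumerical.lean`: interpolation between
  consecutive colossally abundant numbers, §3 Prop. 1 = `Robin1984_prop1_holds`, and the range
  `5040 < n ≤ 55440` by certified computation).
* `robin_iff_of_nicolas` — `Literature.NumberTheory.LFunctions.robin_iff` from the four facts (converse half:
  `robinInequality_imp_riemannHypothesis_of_nicolas`, `RobinOscillation.lean`);
  `robin_iff_of_nicolas_of_oscillation` — the same with Robin's `Ω₊`-theorem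
  `Robin1984_sigma_oscillation` (`LagariasCriterion.lean`) in place of Nicolas's;
  `lagarias_iff_of_nicolas` — likewise `Literature.NumberTheory.LFunctions.lagarias_iff` (Lagarias 2002, Thm. 1.1, whose
  proof runs through Robin's two theorems).

## References

* G. Robin, J. Math. Pures Appl. 63 (1984), 187–213, Thm. 1, §3, §4 Prop. 1. [Robin1984]
* J.-L. Nicolas, Acta Arith. 155 (2012), 311–321. [Nicolas2012]
* J.-L. Nicolas, J. Number Theory 17 (1983), 375–388. [Nicolas1983]
* L. Schoenfeld, Math. Comp. 30 (1976), 337–360. [Schoenfeld1976]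
* K. Briggs, Experiment. Math. 15 (2006), 251–256; C. Axler, Bull. Aust. Math. Soc. 96 (2017).
  [Briggs2006] [Axler2017]
* J. C. Lagarias, Amer. Math. Monthly 109 (2002), 534–543, Thm. 1.1. [Lagarias2002]
-/

noncomputable section

open Real
open scoped Chebyshev ArithmeticFunction.sigma

namespace Literature.NumberTheory.LFunctions

/-- **The colossally abundant case of Robin's Thm. 1** from Nicolas's Mertens bound,
Schoenfeld's `θ`-bound and Briggs's computation: under RH, `σ(N) < e^γ N log log N` for every
colossally abundant `N > 5040`. [cite: Robin1984, §3 (proof of Thm. 1)] -/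
theorem Robin1984_thm1_colossallyAbundant_of_nicolas (hN : Nicolas2012_logf_lower)
    (hS : Schoenfeld1976_theta) (hB : Briggs2006_robinInequality_le) :
    Robin1984_thm1_colossallyAbundant := by
  intro hRH N hCA h5040
  obtain ⟨ε, P, Q, -, -, hP, -, -, hQP, -, -, -, hσ, hθ, hsize⟩ := hCA.exists_structure
  by_cases hsmall : (P : ℝ) < 2 * 10 ^ 10
  · -- below the threshold: `N ≤ 10^(10^10)`, Briggs's range
    have h1 := RobinAnalytic.theta_add_size_le hS hRH hP.two_le hsmall
    have h2 : Real.log N ≤ ((10 ^ 10 : ℕ) : ℝ) * Real.log 10 := by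
      push_cast
      linarith
    exact hB N h5040 (RobinAnalytic.nat_le_ten_pow_of_log_le h2)
  · -- above: the analytic estimate
    push Not at hsmall
    have hlt := RobinAnalytic.mertens_prod_lt hN hS hRH hsmall hQP
    have hN0 : N ≠ 0 := by omega
    have hNpos : (0 : ℝ) < N := by exact_mod_cast Nat.pos_of_ne_zero hN0
    have hθpos : 0 < θ P + θ Q := by
      have h1 : 0 < θ (P : ℝ) := Chebyshev.theta_pos (by exact_mod_cast hP.two_le)
      have h2 : 0 ≤ θ (Q : ℝ) := Chebyshev.theta_nonneg _
      linarith
    have hlog : Real.log (θ P + θ Q) ≤ Real.log (Real.log N) := Real.log_le_log hθpos hθ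
    have hlt' : (σ 1 N : ℝ) / N < rexp eulerMascheroniConstant * Real.log (Real.log N) :=
      lt_of_le_of_lt hσ (hlt.trans_le (mul_le_mul_of_nonneg_left hlog (Real.exp_pos _).le))
    unfold robinInequality
    rw [div_lt_iff₀ hNpos] at hlt'
    linarith

/-- **Robin's Thm. 1** (`RH ⟹ σ(n) < e^γ n log log n` for `n > 5040`) from the three facts,
through `Robin1984_thm1_of_colossallyAbundant` (interpolation between consecutive colossally
abundant numbers, Robin's §3 Prop. 1 = `Robin1984_prop1_holds`, and the certified range
`5040 < n ≤ 55440`). [cite: Robin1984, Thm. 1] -/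
theorem Robin1984_thm1_of_nicolas (hN : Nicolas2012_logf_lower) (hS : Schoenfeld1976_theta)
    (hB : Briggs2006_robinInequality_le) : Robin1984_thm1 :=
  Robin1984_thm1_of_colossallyAbundant (Robin1984_thm1_colossallyAbundant_of_nicolas hN hS hB)
    Robin1984_prop1_holds

/-- **Robin's criterion from four published facts**: `Literature.NumberTheory.LFunctions.robin_iff` follows from Nicolas's
Mertens bound under RH, Schoenfeld's `θ`-bound under RH, Briggs's computation, and Nicolas's
`Ω`-theorem. Once these are discharged,
`robin_iff_holds := robin_iff_of_nicolas …_holds …_holds …_holds …_holds`.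
[cite: Robin1984, Thm. 1 and §4 Prop. 1] -/
theorem robin_iff_of_nicolas (hN : Nicolas2012_logf_lower) (hS : Schoenfeld1976_theta)
    (hB : Briggs2006_robinInequality_le) (hΩ : Nicolas1983_logf_omega) : robin_iff :=
  robin_iff_iff.2
    ⟨Robin1984_thm1_of_nicolas hN hS hB, robinInequality_imp_riemannHypothesis_of_nicolas hΩ⟩

/-- Variant with Robin's own `Ω₊`-theorem `Robin1984_sigma_oscillation` (§4 Prop. 1 =
Lagarias 2002 Prop. 3.2, `LagariasCriterion.lean`; its discharge by Nicolas's method and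
Landau's theorem is in progress in the tree, `NicolasMellin.lean`) as the fourth hypothesis, so
that `robin_iff` then rests on the three forward facts only.
[cite: Robin1984, Thm. 1 and §4 Prop. 1] -/
theorem robin_iff_of_nicolas_of_oscillation (hN : Nicolas2012_logf_lower)
    (hS : Schoenfeld1976_theta) (hB : Briggs2006_robinInequality_le)
    (h₂ : Robin1984_sigma_oscillation) : robin_iff :=
  robin_iff_of_robin1984 (Robin1984_thm1_of_nicolas hN hS hB) h₂

/-- **Lagarias's criterion from the same four facts**: `Literature.NumberTheory.LFunctions.lagarias_iff` through
`lagarias_iff_of_robin'` (`LagariasCriterion.lean`), Robin's Thm. 1 in Lagarias's non-strict form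
(`Robin1984_sigma_le_of_robin_iff`) and Robin's `Ω₊`-theorem
(`Robin1984_sigma_oscillation_of_nicolas`). [cite: Lagarias2002, Thm. 1.1 (proof via Robin1984)] -/
theorem lagarias_iff_of_nicolas (hN : Nicolas2012_logf_lower) (hS : Schoenfeld1976_theta)
    (hB : Briggs2006_robinInequality_le) (hΩ : Nicolas1983_logf_omega) : lagarias_iff :=
  lagarias_iff_of_robin' (Robin1984_sigma_le_of_robin_iff (robin_iff_of_nicolas hN hS hB hΩ))
    (Robin1984_sigma_oscillation_of_nicolas hΩ)

end Literature.NumberTheory.LFunctions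

end
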